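import Literature.NumberTheory.CubicFields.HasseCubicClassFields
import Literature.NumberTheory.CubicFields.ThreeTorsionBridge
import Literature.NumberTheory.CubicFields.CubicResolventClosure
import Literature.NumberTheory.NumberFields.UnramifiedCubicResolventDiscriminant
import Literature.NumberTheory.NumberFields.UnramifiedIffDiscriminant
import HarnessLib

/-!
# The cubic field of discriminant `d_k` cut out by an unramified cyclic cubic extension of a quadratic field `k`

Topic `Literature/NumberTheory/CubicFields`.  Theorem-only file (no definition, no named fact,
D-0026), continuing `HasseCubicClassFields.lean`: for a QUADRATIC field `k` and `E ∈ 𝓔(k)` (an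
intermediate field of `k̄/k`, Galois of degree `3` over `k`, unramified at every finite prime):

* `conj_mem_of_mem` — `E` is stable under `Aut(k̄/ℚ)` (`E` carries class field data,
  `exists_frobData_of_mem`, and the class fields of a quadratic field are normal over `ℚ`,
  `apply_mem_of_frobData`: `Gal(k/ℚ)` acts on `Cl(𝓞_k)` by inversion);
* `isGalois_rat_of_mem` — hence `E/ℚ` is Galois of degree `6` (a number field);
* `exists_cubicSubfield_of_mem` — **`E` contains a cubic field of discriminant `d_k`**: the fixed
  field `F` of an involution of `Gal(E/ℚ)` is cubic, and `d_F = d_{k'}` for the copy `k' ⊆ E` of `k`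
  because `E/k'` is unramified (`|d_E| = |d_k|³`, `UnramifiedIffDiscriminant`, and Hasse's
  `d(K₃) = d(K₂)`, `discr_eq_discr_of_unramified`); it is represented by a member of
  `cubicSubfieldsOfDisc (discr k)` (`ThreeTorsionBridge`);
* `eq_of_algHom_of_conj_mem` — **two cubic extensions `E, E'` of `k` inside `k̄`, `E` normal over `ℚ`,
  receiving `ℚ`-embeddings of the same cubic field coincide**: an automorphism of `k̄/ℚ` carries one
  embedding to the other and stabilises `E`, so the image generates over `k` a subfield of `E ⊓ E'`
  of degree `3` over `k` (degree `1` is excluded since a cubic field does not embed in `k`).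

Together with `HasseUnramifiedResolvent.lean` (the converse direction) these give the bijection
"unramified `C₃`-extensions of `ℚ(√D)` ↔ cubic fields of discriminant `D`" of Hasse's count
(BST §8.1, §8.5; Davenport–Heilbronn §6), assembled in `HasseDictionaryProofs.lean`.

## References

* H. Hasse, Math. Z. 31 (1930) 565–582. [Hasse1930]
* M. Bhargava, A. Shankar, J. Tsimerman, Invent. Math. 193 (2013) = arXiv:1005.0672, §8.1, §8.5.
  [BhargavaShankarTsimerman2012]
* H. Davenport, H. Heilbronn, Proc. Roy. Soc. London A 322 (1971) 405–420, §6. [DavenportHeilbronn1971]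
* D. A. Cox, *Primes of the form x² + ny²*, 2nd ed. (2013), Lemma 9.3. [Cox2013]
-/

noncomputable section

open NumberField IsDedekindDomain Module IntermediateField
open scoped nonZeroDivisors

namespace Literature.NumberTheory.CubicFields

open Literature.NumberTheory.NumberFields Literature.NumberTheory.QuadraticFields
  Literature.NumberTheory.GaloisRepresentations

variable {k : Type} [Field k] [NumberField k]

/-! ### Normality over `ℚ` -/

/-- **The unramified cubic extensions of a quadratic field are stable under `Aut(k̄/ℚ)`**: `E`
carries class field data `(ψ, χ)` (`exists_frobData_of_mem`) and the class fields of a quadratic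
field are normal over `ℚ` (`apply_mem_of_frobData`, Cox Lemma 9.3). [cite: Cox2013, §9.A Lemma 9.3] -/
theorem conj_mem_of_mem [IsGalois ℚ k] (hk : finrank ℚ k = 2)
    {E : IntermediateField k (AlgebraicClosure k)}
    (hE : E ∈ {E : IntermediateField k (AlgebraicClosure k) | IsGalois k E ∧ finrank k E = 3 ∧
      ∀ v : HeightOneSpectrum (𝓞 k), Algebra.IsUnramifiedIn (𝓞 E) v.asIdeal})
    (g : AlgebraicClosure k ≃ₐ[ℚ] AlgebraicClosure k) {x : AlgebraicClosure k} (hx : x ∈ E) :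
    g x ∈ E := by
  obtain ⟨hfd, hgal, -, ψ, χ, -, -, hχ, hfrob⟩ := exists_frobData_of_mem hE
  haveI := hfd
  haveI := hgal
  have hm : IsGalois k E ∧ finrank k E = 3 ∧
      ∀ v : HeightOneSpectrum (𝓞 k), Algebra.IsUnramifiedIn (𝓞 E) v.asIdeal := hE
  exact apply_mem_of_frobData hk hm.2.2 hχ hfrob g hx

/-- **`E/ℚ` is Galois of degree `6`** for `E ∈ 𝓔(k)`, `k` quadratic: normal over `ℚ` by
`conj_mem_of_mem` (inside the normal extension `k̄/ℚ`), of degree `[E:k][k:ℚ] = 6`; in particular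
`E` is a number field. [folklore] -/
theorem isGalois_rat_of_mem [IsGalois ℚ k] (hk : finrank ℚ k = 2)
    {E : IntermediateField k (AlgebraicClosure k)}
    (hE : E ∈ {E : IntermediateField k (AlgebraicClosure k) | IsGalois k E ∧ finrank k E = 3 ∧
      ∀ v : HeightOneSpectrum (𝓞 k), Algebra.IsUnramifiedIn (𝓞 E) v.asIdeal}) :
    ∃ (_ : FiniteDimensional k E) (_ : NumberField E) (_ : IsGalois ℚ E), finrank ℚ E = 6 := by
  have hm : IsGalois k E ∧ finrank k E = 3 ∧
      ∀ v : HeightOneSpectrum (𝓞 k), Algebra.IsUnramifiedIn (𝓞 E) v.asIdeal := hE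
  obtain ⟨-, h3, -⟩ := hm
  haveI : FiniteDimensional k E := Module.finite_of_finrank_eq_succ h3
  haveI : FiniteDimensional ℚ E := Module.Finite.trans k E
  haveI : CharZero E := charZero_of_injective_algebraMap (algebraMap k E).injective
  haveI : NumberField E := NumberField.mk
  haveI hIAC : IsAlgClosure ℚ (AlgebraicClosure k) := isAlgClosure_rat_algebraicClosure
  haveI : Normal ℚ (AlgebraicClosure k) := IsAlgClosure.normal ℚ _
  have hnorm := (IntermediateField.normal_iff_forall_map_le' (K := E.restrictScalars ℚ)).mpr
    (fun σ x hx => by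
      rw [IntermediateField.mem_map] at hx
      obtain ⟨y, hy, rfl⟩ := hx
      rw [IntermediateField.mem_restrictScalars] at hy ⊢
      exact conj_mem_of_mem hk hE σ hy)
  haveI : Normal ℚ E := IntermediateField.restrictScalars_normal.mp hnorm
  haveI : Algebra.IsSeparable ℚ E := Algebra.IsAlgebraic.isSeparable_of_perfectField
  haveI : IsGalois ℚ E := IsGalois.mk
  refine ⟨inferInstance, inferInstance, inferInstance, ?_⟩
  have h := Module.finrank_mul_finrank ℚ k E
  rw [hk, h3] at h
  omega

/-! ### The cubic subfield of discriminant `d_k` -/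

/-- **An unramified cyclic cubic extension of the quadratic field `k` contains a cubic field of
discriminant `d_k`** (Hasse 1930; BST §8.1: `Disc K₃ = Disc K₂` when `K₆/K₂` is unramified).
With `E/ℚ` Galois of degree `6` (`isGalois_rat_of_mem`): the fixed field `F` of an involution of
`Gal(E/ℚ)` is cubic; `E` is unramified over the copy `k' ⊆ E` of `k` (`|d_E| = |d_k|³`,
`forall_isUnramifiedIn_iff_natAbs_discr_eq` twice), so `d_F = d_{k'} = d_k`
(`discr_eq_discr_of_unramified`); and `F` is represented in `cubicSubfieldsOfDisc (discr k)`.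
[cite: Hasse1930, Math. Z. 31, §1] [cite: BhargavaShankarTsimerman2012, §8.1] -/
theorem exists_cubicSubfield_of_mem [IsGalois ℚ k] (hk : finrank ℚ k = 2)
    {E : IntermediateField k (AlgebraicClosure k)}
    (hE : E ∈ {E : IntermediateField k (AlgebraicClosure k) | IsGalois k E ∧ finrank k E = 3 ∧
      ∀ v : HeightOneSpectrum (𝓞 k), Algebra.IsUnramifiedIn (𝓞 E) v.asIdeal}) :
    ∃ F₀ : FiniteSubfield, F₀ ∈ cubicSubfieldsOfDisc (discr k) ∧ Nonempty (F₀ →ₐ[ℚ] E) := by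
  classical
  obtain ⟨hfd, hnf, hgalQ, h6⟩ := isGalois_rat_of_mem hk hE
  haveI := hfd
  haveI := hnf
  haveI := hgalQ
  have hm : IsGalois k E ∧ finrank k E = 3 ∧
      ∀ v : HeightOneSpectrum (𝓞 k), Algebra.IsUnramifiedIn (𝓞 E) v.asIdeal := hE
  obtain ⟨-, h3, hunr⟩ := hm
  -- an involution of `Gal(E/ℚ)` and its cubic fixed field
  haveI : Fact (Nat.Prime 2) := ⟨Nat.prime_two⟩
  letI : Fintype (E ≃ₐ[ℚ] E) := Fintype.ofFinite _
  have hG : Fintype.card (E ≃ₐ[ℚ] E) = 6 := by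
    rw [← Nat.card_eq_fintype_card, IsGalois.card_aut_eq_finrank, h6]
  obtain ⟨τ, hτ⟩ := exists_prime_orderOf_dvd_card (G := E ≃ₐ[ℚ] E) 2 (by rw [hG]; norm_num)
  set F : IntermediateField ℚ E := IntermediateField.fixedField (Subgroup.zpowers τ) with hFdef
  have hFE : finrank F E = 2 := by
    rw [hFdef, IntermediateField.finrank_fixedField_eq_card, Nat.card_zpowers, hτ]
  have hF3 : finrank ℚ F = 3 := by
    have h := Module.finrank_mul_finrank ℚ F E
    rw [hFE, h6] at h
    omega
  -- the copy `k'` of `k` inside `E`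
  set k' : IntermediateField ℚ E := (IsScalarTower.toAlgHom ℚ k E).fieldRange with hk'def
  have ek : k ≃ₐ[ℚ] k' := AlgEquiv.ofInjectiveField (IsScalarTower.toAlgHom ℚ k E)
  have hk'2 : finrank ℚ k' = 2 := by
    rw [← hk]
    exact (LinearEquiv.finrank_eq ek.toLinearEquiv).symm
  have hdk' : discr k' = discr k := (NumberField.discr_eq_discr_of_algEquiv k ek).symm
  have hk'E : finrank k' E = 3 := by
    have h := Module.finrank_mul_finrank ℚ k' E
    rw [hk'2, h6] at h
    omega
  -- `E/k'` is unramified: `|d_E| = |d_k|³ = |d_{k'}|³`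
  have hnum : (discr E).natAbs = (discr k).natAbs ^ 3 := by
    rw [← h3]
    exact (forall_isUnramifiedIn_iff_natAbs_discr_eq (K := k) (L := E)).mp hunr
  have hunr' : ∀ (Q : Ideal (𝓞 E)) [Q.IsMaximal], Algebra.IsUnramifiedAt (𝓞 k') Q :=
    (forall_isUnramifiedAt_iff_natAbs_discr_eq (K := k') (L := E)).mpr (by rw [hk'E, hdk', hnum])
  -- Hasse: `d_F = d_{k'} = d_k`
  have hdF : discr F = discr k := (discr_eq_discr_of_unramified k' F hk'2 hF3 h6 hunr').trans hdk'
  obtain ⟨F₀, hF₀, ⟨e⟩⟩ := exists_mem_cubicSubfieldsOfDisc_algEquiv F hF3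
  rw [hdF] at hF₀
  exact ⟨F₀, hF₀, ⟨(IntermediateField.val F).comp (e.symm : (F₀ : Type) →ₐ[ℚ] F)⟩⟩

/-! ### Uniqueness: one cubic field, one unramified cubic extension -/

/-- **A cubic field embeds in the quadratic field `k`'s extension `E` of degree `3` only off the
bottom**: if the cubic `F₀` embeds `ℚ`-linearly and injectively into `k`, then `3 ≤ 2`. Here in the
form used below: no `ℚ`-algebra map `F₀ → k̄` with values in the image of `k`. [folklore] -/
theorem not_forall_mem_range_algebraMap (hk : finrank ℚ k = 2) {F₀ : Type*} [Field F₀]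
    [NumberField F₀] (hF₀ : finrank ℚ F₀ = 3) (b : F₀ →ₐ[ℚ] AlgebraicClosure k) :
    ¬ ∀ x : F₀, b x ∈ Set.range (algebraMap k (AlgebraicClosure k)) := by
  intro h
  choose c hc using h
  have hinj := (algebraMap k (AlgebraicClosure k)).injective
  let f : F₀ →ₗ[ℚ] k :=
    { toFun := c
      map_add' := fun x y => hinj (by rw [map_add, hc, hc, hc, map_add])
      map_smul' := fun q x => hinj (by
        rw [RingHom.id_apply, hc, Algebra.smul_def, Algebra.smul_def, map_mul, map_mul,
          AlgHom.commutes, hc, ← IsScalarTower.algebraMap_apply]) }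
  have hf : Function.Injective f := by
    intro x y hxy
    apply b.toRingHom.injective
    change b x = b y
    rw [← hc x, ← hc y]
    exact congrArg _ hxy
  have := LinearMap.finrank_le_finrank_of_injective hf
  rw [hF₀, hk] at this
  omega

/-- **Two cubic extensions of `k` inside `k̄` receiving the same cubic field coincide, if one of
them is normal over `ℚ`.**  Let `k` be quadratic, `E, E' ⊆ k̄` of degree `3` over `k` with `E`
stable under `Aut(k̄/ℚ)`, and `F₀` a cubic number field with `ℚ`-embeddings `a : F₀ → E`,
`a' : F₀ → E'`.  An automorphism `g` of `k̄/ℚ` carries `a` to `a'` (extension of isomorphisms to the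
normal `k̄/ℚ`), so `a'(F₀) ⊆ g(E) ∩ E' = E ∩ E'`; the field `k(a'(F₀))` then has degree `3` over `k`
inside both `E` and `E'` (degree `1` would embed `F₀` into `k`), hence `E = k(a'(F₀)) = E'`.
(For the `S₃`-closures: a cubic field determines its Galois closure.) [folklore] -/
theorem eq_of_algHom_of_conj_mem (hk : finrank ℚ k = 2)
    {E E' : IntermediateField k (AlgebraicClosure k)} [FiniteDimensional k E]
    [FiniteDimensional k E'] (h3 : finrank k E = 3) (h3' : finrank k E' = 3)
    (hE : ∀ (g : AlgebraicClosure k ≃ₐ[ℚ] AlgebraicClosure k) {x : AlgebraicClosure k},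
      x ∈ E → g x ∈ E)
    {F₀ : Type*} [Field F₀] [NumberField F₀] (hF₀ : finrank ℚ F₀ = 3)
    (a : F₀ →ₐ[ℚ] E) (a' : F₀ →ₐ[ℚ] E') : E = E' := by
  classical
  haveI hIAC : IsAlgClosure ℚ (AlgebraicClosure k) := isAlgClosure_rat_algebraicClosure
  haveI : Normal ℚ (AlgebraicClosure k) := IsAlgClosure.normal ℚ _
  -- the two embeddings into `(AlgebraicClosure k)`
  set b : F₀ →ₐ[ℚ] (AlgebraicClosure k) := (IsScalarTower.toAlgHom ℚ E (AlgebraicClosure k)).comp a with hbdef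
  set b' : F₀ →ₐ[ℚ] (AlgebraicClosure k) := (IsScalarTower.toAlgHom ℚ E' (AlgebraicClosure k)).comp a' with hb'def
  have hbval : ∀ x, b x = (a x : (AlgebraicClosure k)) := fun x => rfl
  have hb'val : ∀ x, b' x = (a' x : (AlgebraicClosure k)) := fun x => rfl
  -- an automorphism `g` of `(AlgebraicClosure k)/ℚ` with `g ∘ b = b'`
  set e₁ : F₀ ≃ₐ[ℚ] b.fieldRange := AlgEquiv.ofInjectiveField b with he₁def
  set e₂ : F₀ ≃ₐ[ℚ] b'.fieldRange := AlgEquiv.ofInjectiveField b' with he₂def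
  have he₁ : ∀ x, algebraMap b.fieldRange (AlgebraicClosure k) (e₁ x) = b x := fun x => rfl
  have he₂ : ∀ x, algebraMap b'.fieldRange (AlgebraicClosure k) (e₂ x) = b' x := fun x => rfl
  set φ : b.fieldRange ≃ₐ[ℚ] b'.fieldRange := e₁.symm.trans e₂ with hφdef
  set g : AlgebraicClosure k ≃ₐ[ℚ] AlgebraicClosure k := φ.liftNormal (AlgebraicClosure k) with hgdef
  have hg : ∀ x, g (b x) = b' x := by
    intro x
    have h := AlgEquiv.liftNormal_commutes φ (AlgebraicClosure k) (e₁ x)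
    have h2 : φ (e₁ x) = e₂ x := by
      rw [hφdef, AlgEquiv.trans_apply, AlgEquiv.symm_apply_apply]
    rw [he₁, h2, he₂] at h
    exact h
  -- `b'(F₀) ⊆ E ∩ E'`
  have hbE : ∀ x, b' x ∈ E := fun x => by
    rw [← hg, hbval]
    exact hE g (a x).2
  have hbE' : ∀ x, b' x ∈ E' := fun x => by
    rw [hb'val]
    exact (a' x).2
  -- `M = k(b'(F₀))` has degree `3` over `k` inside `E` and `E'`
  set M : IntermediateField k (AlgebraicClosure k) := IntermediateField.adjoin k (Set.range b') with hMdef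
  have hME : M ≤ E := IntermediateField.adjoin_le_iff.mpr (by rintro _ ⟨x, rfl⟩; exact hbE x)
  have hME' : M ≤ E' := IntermediateField.adjoin_le_iff.mpr (by rintro _ ⟨x, rfl⟩; exact hbE' x)
  have key : ∀ {N : IntermediateField k (AlgebraicClosure k)} [FiniteDimensional k N],
      finrank k N = 3 → M ≤ N → M = N := by
    intro N _ hN hMN
    have hdvd : finrank k M ∣ 3 := hN ▸ IntermediateField.finrank_dvd_of_le_right hMN
    rcases (Nat.dvd_prime Nat.prime_three).mp hdvd with h1 | h3M
    · exfalso
      have hMbot : M = ⊥ := IntermediateField.finrank_eq_one_iff.mp h1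
      refine not_forall_mem_range_algebraMap hk hF₀ b' fun x => ?_
      have hx : b' x ∈ M := IntermediateField.subset_adjoin k _ ⟨x, rfl⟩
      rw [hMbot, IntermediateField.mem_bot] at hx
      exact hx
    · exact IntermediateField.eq_of_le_of_finrank_eq hMN (h3M.trans hN.symm)
  exact (key h3 hME).symm.trans (key h3' hME')

end Literature.NumberTheory.CubicFields

end
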